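import Summits.AtomisticToContinuum.Crystallization.Theorems.SquareWellLayerCakeStackingFaultSparsityBootstrapGlue
import Summits.AtomisticToContinuum.Crystallization.Theorems.SquareWellLayerCakeStackingFaultSparsityQualitativeRigidity

/-!
# Radius bootstrap of crux 14294: item 14294 `LaminarSaturation` from its radius-2 energy stub ALONE

Crux `StackingFaultSparsity` (stmt-AtomisticToContinuum-14296), line `Sketch`, reshape 15 (lead c8).  With the radius
bootstrap PROVED (`…Bootstrap.Glue.stub_radiusBootstrap` = item 14294's registered `stub_radiusBootstrap` by name and
signature, from the landed W1–W4), the birth skeleton of item 14294 (`Cruxes/LaminarSaturation/Lines/birth.lean`: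
`LaminarSaturation ⇐ stub_energyGap + stub_radiusBootstrap`) closes modulo its radius-2 energy stub only:

* `tendsto_density_of_gap_of_bootstrap'` — the real-analysis squeeze of that assembly (ported);
* `laminarSaturation_of_energyGap : <stub_energyGap> → LaminarSaturation` — item 14294 from its ONE remaining stub;
* `goodLaminarWindowsAE_of_laminarity_energyGap` — `LjLaminarity → <stub_energyGap> →` GOOD laminar windows a.e. at every
  `(R ≥ 2, ε > 0)` (the consequent of 14294 = the strategist's split child `GoodLaminarWindowsAE`, SPLIT-READY.md), so that
  the laminar board's residual {14293, energyGap} and the item pair {14293, 14294} are now CERTIFIED EQUIVALENT inputs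
  (the converse direction is `h14294 h14293`);
* `laminarBarlowWindows_of_goodFramesAE`, `stackingFaultSparsity_of_goodFramesAE{,'}` — the board's MINIMAL physics interface
  (split child 1′ of SPLIT-READY.md): a.e. GOOD`(2, 1, ε)` frames for every `ε > 0` ⇒ item 14292 and the crux (both copies).
All `[folklore]` bookkeeping.
-/

noncomputable section

namespace Summit.AtomisticToContinuum.Crystallization.Theorems.SquareWellLayerCake.StackingFaultSparsity.Bootstrap.Board

open Filter Topology
open Literature.MathematicalPhysics.StatisticalMechanics
open Summit.AtomisticToContinuum.Crystallization.Theses.LaminarSixThreeThree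

/-- Real-analysis core of 14294's birth assembly (ported from `Cruxes/LaminarSaturation/Lines/birth.lean`): a density
squeezed between `0` and `C₂ · ((excess energy density + C₁ · density₂ + s/N) / γ + density₁)`. [folklore] -/
theorem tendsto_density_of_gap_of_bootstrap' {f b g₁ g₂ E s : ℕ → ℝ} {γ C₁ C₂ e : ℝ}
    (hγ : 0 < γ) (hC₂ : 0 ≤ C₂)
    (hboot : ∀ N, f N ≤ C₂ * (b N + g₁ N))
    (hgap : ∀ N, γ * b N ≤ (E N - (N : ℝ) * e) + C₁ * g₂ N + s N)
    (hf : ∀ N, 0 ≤ f N)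
    (hg₁ : Tendsto (fun N : ℕ => g₁ N / (N : ℝ)) atTop (𝓝 0))
    (hg₂ : Tendsto (fun N : ℕ => g₂ N / (N : ℝ)) atTop (𝓝 0))
    (hE : Tendsto (fun N : ℕ => E N / (N : ℝ)) atTop (𝓝 e))
    (hs : Tendsto (fun N : ℕ => s N / (N : ℝ)) atTop (𝓝 0)) :
    Tendsto (fun N : ℕ => f N / (N : ℝ)) atTop (𝓝 0) := by
  have hup : Tendsto (fun N : ℕ =>
      C₂ * (((E N / (N : ℝ) - e) + C₁ * (g₂ N / (N : ℝ)) + s N / (N : ℝ)) / γ + g₁ N / (N : ℝ)))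
      atTop (𝓝 0) := by
    have h1 : Tendsto (fun N : ℕ => E N / (N : ℝ) - e) atTop (𝓝 0) := by
      simpa using hE.sub_const e
    have h2 := (((h1.add (hg₂.const_mul C₁)).add hs).div_const γ).add hg₁
    simpa using h2.const_mul C₂
  refine tendsto_of_tendsto_of_tendsto_of_le_of_le' tendsto_const_nhds hup ?_ ?_
  · exact Filter.Eventually.of_forall fun N => div_nonneg (hf N) (Nat.cast_nonneg N)
  · filter_upwards [Filter.eventually_gt_atTop 0] with N hN
    have hN : (0 : ℝ) < N := Nat.cast_pos.mpr hN
    have hb : b N ≤ ((E N - (N : ℝ) * e) + C₁ * g₂ N + s N) / γ := by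
      rw [le_div_iff₀ hγ]
      linarith [hgap N]
    have hfN : f N ≤ C₂ * (((E N - (N : ℝ) * e) + C₁ * g₂ N + s N) / γ + g₁ N) :=
      (hboot N).trans (mul_le_mul_of_nonneg_left (add_le_add hb le_rfl) hC₂)
    have hdiv : f N / (N : ℝ) ≤ C₂ * (((E N - (N : ℝ) * e) + C₁ * g₂ N + s N) / γ + g₁ N) / (N : ℝ) :=
      div_le_div_of_nonneg_right hfN hN.le
    refine hdiv.trans (le_of_eq ?_)
    field_simp

/-- **Item 14294 `LaminarSaturation` BY NAME from its radius-2 energy stub alone** (the registered `stub_energyGap` of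
its birth skeleton, taken as the hypothesis; the second registered stub `stub_radiusBootstrap` is the landed
`Bootstrap.Glue.stub_radiusBootstrap`): bootstrap at `(R, ε)`, energy gap at `ε'`, `LjLaminarity` at the two laminarity
scales, `CrysEnergyLimit_holds`, squeeze. [folklore] -/
theorem laminarSaturation_of_energyGap :
    (∀ ε : ℝ, 0 < ε → ∃ t R₀ γ C : ℝ, 0 < t ∧ 0 < R₀ ∧ 0 < γ ∧ 0 ≤ C ∧ ∃ s : ℕ → ℝ, Filter.Tendsto (fun N : ℕ => s N / (N : ℝ)) Filter.atTop (nhds 0) ∧ ∀ (N : ℕ) (y : Fin N → EuclideanSpace ℝ (Fin 3)), Literature.MathematicalPhysics.StatisticalMechanics.IsGroundState Literature.MathematicalPhysics.StatisticalMechanics.lennardJones y → γ * (Nat.card {i : Fin N // ¬ (∃ a b : ℝ, 19 / 20 ≤ a ∧ a ≤ 1 ∧ 19 / 20 ≤ b ∧ b ≤ 1 ∧ ∃ n : EuclideanSpace ℝ (Fin 3), ‖n‖ = 1 ∧ ∃ c : ℤ → ℝ, (∀ k : ℤ, c k + 19 / 25 ≤ c (k + 1)) ∧ ∃ l : Fin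 N → ℤ, (∀ j : Fin N, dist (y j) (y i) ≤ 2 → |inner ℝ (y j - y i) n - c (l j)| ≤ ε) ∧ (∀ j k : Fin N, dist (y j) (y i) ≤ 2 → dist (y k) (y i) ≤ 2 → j ≠ k → 19 / 20 ≤ dist (y j) (y k)) ∧ ∀ j : Fin N, dist (y j) (y i) ≤ 1 → Nat.card {k : Fin N // k ≠ j ∧ l k = l j ∧ dist (y j) (y k) ≤ 1} = 6 ∧ Nat.card {k : Fin N // l k = l j + 1 ∧ dist (y j) (y k) ≤ 1} = 3 ∧ Nat.card {k : Fin N // l k = l j - 1 ∧ dist (y j) (y k) ≤ 1} = 3 ∧ ∀ k : Fin N, k ≠ j → dist (y j) (y k) ≤ 1 → (l k = l j → |dist (y j) (y k) - a| ≤ ε) ∧ (l k ≠ l j → |dist (y j) (y k) - b| ≤ ε))} : ℝ) ≤ (Literature.MathematicalPhysics.StatisticalMechanics.interactionEnergy Literature.MathematicalPhysics.StatisticalMechanics.lennardJones y - (N : ℝ) * (⨅ Q : Literature.MathematicalPhysics.StatisticalMechanics.PeriodicConfiguration 3, Q.energyPerParticle Literature.MathematicalPhysics.StatisticalMechanics.lennardJones))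 + C * (Nat.card {i : Fin N // ¬ (∃ n : EuclideanSpace ℝ (Fin 3), ‖n‖ = 1 ∧ ∃ c : ℤ → ℝ, (∀ k : ℤ, c k + 3 / 4 ≤ c (k + 1)) ∧ ∀ j : Fin N, dist (y j) (y i) ≤ R₀ → ∃ k : ℤ, |inner ℝ (y j - y i) n - c k| ≤ t)} : ℝ) + s N) → LaminarSaturation := by
  intro hE hLam R ε hR hε x hx
  obtain ⟨ε', t₁, R₁, C₂, hε', ht₁, hR₁, hC₂, hboot⟩ := Glue.stub_radiusBootstrap R ε hR hε
  obtain ⟨t₂, R₂, γ, C₁, ht₂, hR₂, hγ, _hC₁, s, hs, hgap⟩ := hE ε' hε'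
  have h0 : Tendsto (fun N : ℕ => groundStateEnergy lennardJones 3 N / (N : ℝ)) atTop
      (𝓝 (⨅ Q : Literature.MathematicalPhysics.StatisticalMechanics.PeriodicConfiguration 3,
        Q.energyPerParticle Literature.MathematicalPhysics.StatisticalMechanics.lennardJones)) :=
    CrysEnergyLimit_holds
  exact tendsto_density_of_gap_of_bootstrap' hγ hC₂ (fun N => hboot N (x N) (hx N))
    (fun N => hgap N (x N) (hx N)) (fun N => Nat.cast_nonneg _) (hLam t₁ R₁ ht₁ hR₁ x hx)
    (hLam t₂ R₂ ht₂ hR₂ x hx) (h0.congr fun N => by rw [(hx N).2]) hs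

/-- **GOOD laminar windows a.e. (the consequent of item 14294 = split child `GoodLaminarWindowsAE`) from `LjLaminarity` and
the radius-2 energy stub.** [folklore] -/
theorem goodLaminarWindowsAE_of_laminarity_energyGap (hLam : LjLaminarity)
    (hE : ∀ ε : ℝ, 0 < ε → ∃ t R₀ γ C : ℝ, 0 < t ∧ 0 < R₀ ∧ 0 < γ ∧ 0 ≤ C ∧ ∃ s : ℕ → ℝ, Filter.Tendsto (fun N : ℕ => s N / (N : ℝ)) Filter.atTop (nhds 0) ∧ ∀ (N : ℕ) (y : Fin N → EuclideanSpace ℝ (Fin 3)), Literature.MathematicalPhysics.StatisticalMechanics.IsGroundState Literature.MathematicalPhysics.StatisticalMechanics.lennardJones y → γ * (Nat.card {i : Fin N // ¬ (∃ a b : ℝ, 19 / 20 ≤ a ∧ a ≤ 1 ∧ 19 / 20 ≤ b ∧ b ≤ 1 ∧ ∃ n : EuclideanSpace ℝ (Fin 3), ‖n‖ = 1 ∧ ∃ c : ℤ → ℝ, (∀ k : ℤ, c k + 19 / 25 ≤ c (k + 1)) ∧ ∃ l : Fin N → ℤ, (∀ j : Fin N, dist (y j) (y i) ≤ 2 → |inner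 ℝ (y j - y i) n - c (l j)| ≤ ε) ∧ (∀ j k : Fin N, dist (y j) (y i) ≤ 2 → dist (y k) (y i) ≤ 2 → j ≠ k → 19 / 20 ≤ dist (y j) (y k)) ∧ ∀ j : Fin N, dist (y j) (y i) ≤ 1 → Nat.card {k : Fin N // k ≠ j ∧ l k = l j ∧ dist (y j) (y k) ≤ 1} = 6 ∧ Nat.card {k : Fin N // l k = l j + 1 ∧ dist (y j) (y k) ≤ 1} = 3 ∧ Nat.card {k : Fin N // l k = l j - 1 ∧ dist (y j) (y k) ≤ 1} = 3 ∧ ∀ k : Fin N, k ≠ j → dist (y j) (y k) ≤ 1 → (l k = l j → |dist (y j) (y k) - a| ≤ ε) ∧ (l k ≠ l j → |dist (y j) (y k) - b| ≤ ε))} : ℝ) ≤ (Literature.MathematicalPhysics.StatisticalMechanics.interactionEnergy Literature.MathematicalPhysics.StatisticalMechanics.lennardJones y - (N : ℝ) * (⨅ Q : Literature.MathematicalPhysics.StatisticalMechanics.PeriodicConfiguration 3, Q.energyPerParticle Literature.MathematicalPhysics.StatisticalMechanics.lennardJones)) + C * (Nat.card {i : Fin N // ¬ (∃ n : EuclideanSpace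 ℝ (Fin 3), ‖n‖ = 1 ∧ ∃ c : ℤ → ℝ, (∀ k : ℤ, c k + 3 / 4 ≤ c (k + 1)) ∧ ∀ j : Fin N, dist (y j) (y i) ≤ R₀ → ∃ k : ℤ, |inner ℝ (y j - y i) n - c k| ≤ t)} : ℝ) + s N) :
    ∀ R ε : ℝ, 2 ≤ R → 0 < ε → ∀ x : (N : ℕ) → (Fin N → EuclideanSpace ℝ (Fin 3)), (∀ N, Literature.MathematicalPhysics.StatisticalMechanics.IsGroundState Literature.MathematicalPhysics.StatisticalMechanics.lennardJones (x N)) → Filter.Tendsto (fun N : ℕ => (Nat.card {i : Fin N // ¬ (∃ a b : ℝ, 19 / 20 ≤ a ∧ a ≤ 1 ∧ 19 / 20 ≤ b ∧ b ≤ 1 ∧ ∃ n : EuclideanSpace ℝ (Fin 3), ‖n‖ = 1 ∧ ∃ c : ℤ → ℝ, (∀ k : ℤ, c k + 19 / 25 ≤ c (k + 1)) ∧ ∃ l : Fin N → ℤ, (∀ j : Fin N, dist (x N j) (x N i) ≤ R → |inner ℝ (x N j - x N i) n - c (l j)| ≤ ε) ∧ (∀ j k : Fin N, dist (x N j) (x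 N i) ≤ R → dist (x N k) (x N i) ≤ R → j ≠ k → 19 / 20 ≤ dist (x N j) (x N k)) ∧ ∀ j : Fin N, dist (x N j) (x N i) ≤ R / 2 → Nat.card {k : Fin N // k ≠ j ∧ l k = l j ∧ dist (x N j) (x N k) ≤ 1} = 6 ∧ Nat.card {k : Fin N // l k = l j + 1 ∧ dist (x N j) (x N k) ≤ 1} = 3 ∧ Nat.card {k : Fin N // l k = l j - 1 ∧ dist (x N j) (x N k) ≤ 1} = 3 ∧ ∀ k : Fin N, k ≠ j → dist (x N j) (x N k) ≤ 1 → (l k = l j → |dist (x N j) (x N k) - a| ≤ ε) ∧ (l k ≠ l j → |dist (x N j) (x N k) - b| ≤ ε))} : ℝ) / N) Filter.atTop (nhds 0) :=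
  laminarSaturation_of_energyGap hE hLam

/-! ## The minimal physics interface of the laminar board: GOOD`(2, 1, ε)` frames a.e. -/

/-- **`LaminarBarlowWindows` (item 14292) from a.e. GOOD`(2, 1, ε)` frames alone** — the weakest input the local-frames
board consumes (the strategist's split child 1′ of SPLIT-READY.md, typed from the landed statements): for every `ε > 0`,
along every LJ ground-state sequence the density of particles without a GOOD`(2, 1, ε)` frame tends to `0`.  Proof: the landed
local rigidity (`localRigidity_of_stubs` on S0/S12/S3/S4) and the packing count `allGoodBall_density_tendsto`, as in
`laminarBarlowWindows_of_localRigidity` with the energy step replaced by the hypothesis.  (`LjLaminarity` ∧ the radius-2 energy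
stub give the hypothesis: `LocalFrames.Counting.goodTwo_density_tendsto`.) [folklore] -/
theorem laminarBarlowWindows_of_goodFramesAE
    (hG : ∀ ε : ℝ, 0 < ε → ∀ x : (N : ℕ) → (Fin N → EuclideanSpace ℝ (Fin 3)),
      (∀ N, IsGroundState lennardJones (x N)) →
      Tendsto (fun N : ℕ => (Nat.card {i : Fin N // ¬ (∃ a b : ℝ, 19 / 20 ≤ a ∧ a ≤ 1 ∧ 19 / 20 ≤ b ∧ b ≤ 1 ∧ ∃ n : EuclideanSpace ℝ (Fin 3), ‖n‖ = 1 ∧ ∃ c : ℤ → ℝ, (∀ k : ℤ, c k + 19 / 25 ≤ c (k + 1)) ∧ ∃ l : Fin N → ℤ, (∀ j : Fin N, dist (x N j) (x N i) ≤ 2 → |inner ℝ (x N j - x N i) n - c (l j)| ≤ ε) ∧ (∀ j k : Fin N, dist (x N j) (x N i) ≤ 2 → dist (x N k) (x N i) ≤ 2 → j ≠ k → 19 / 20 ≤ dist (x N j) (x N k)) ∧ ∀ j : Fin N, dist (x N j) (x N i) ≤ 1 → Nat.card {k : Fin N // k ≠ j ∧ l k = l j ∧ dist (x N j) (x N k)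 ≤ 1} = 6 ∧ Nat.card {k : Fin N // l k = l j + 1 ∧ dist (x N j) (x N k) ≤ 1} = 3 ∧ Nat.card {k : Fin N // l k = l j - 1 ∧ dist (x N j) (x N k) ≤ 1} = 3 ∧ ∀ k : Fin N, k ≠ j → dist (x N j) (x N k) ≤ 1 → (l k = l j → |dist (x N j) (x N k) - a| ≤ ε) ∧ (l k ≠ l j → |dist (x N j) (x N k) - b| ≤ ε))} : ℝ) / N) atTop (𝓝 0)) :
    LaminarBarlowWindows := by
  intro R ε _hR hε _hε4 x hx
  obtain ⟨m, hm⟩ := LocalFrames.Final.localRigidity_of_stubs LocalFrames.Limit.stub_localFrameLimit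
    LocalFrames.OneLength.stub_barlowOfOneLength LocalFrames.CommonNormal.stub_barlowOfCommonNormal
    LocalFrames.Dichotomy.stub_frameDichotomy R ε hε
  have hT := LocalFrames.Counting.allGoodBall_density_tendsto m (1 / ((m : ℝ) + 1))
    (hG (1 / ((m : ℝ) + 1)) (by positivity)) x hx
  refine squeeze_zero (fun N => by positivity) (fun N => ?_) hT
  refine div_le_div_of_nonneg_right (Nat.cast_le.mpr ?_) (Nat.cast_nonneg N)
  refine Nat.card_le_card_of_injective
    (Subtype.map id fun i hi hgood => hi ?_) (Subtype.map_injective _ Function.injective_id)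
  exact hm N (x N) i hgood

/-- **The crux (route `LaminarSixThreeThree` copy) from a.e. GOOD`(2, 1, ε)` frames alone** (p141795 after
`laminarBarlowWindows_of_goodFramesAE`). [folklore] -/
theorem stackingFaultSparsity_of_goodFramesAE
    (hG : ∀ ε : ℝ, 0 < ε → ∀ x : (N : ℕ) → (Fin N → EuclideanSpace ℝ (Fin 3)),
      (∀ N, IsGroundState lennardJones (x N)) →
      Tendsto (fun N : ℕ => (Nat.card {i : Fin N // ¬ (∃ a b : ℝ, 19 / 20 ≤ a ∧ a ≤ 1 ∧ 19 / 20 ≤ b ∧ b ≤ 1 ∧ ∃ n : EuclideanSpace ℝ (Fin 3), ‖n‖ = 1 ∧ ∃ c : ℤ → ℝ, (∀ k : ℤ, c k + 19 / 25 ≤ c (k + 1)) ∧ ∃ l : Fin N → ℤ, (∀ j : Fin N, dist (x N j) (x N i) ≤ 2 → |inner ℝ (x N j - x N i) n - c (l j)| ≤ ε) ∧ (∀ j k : Fin N, dist (x N j) (x N i) ≤ 2 → dist (x N k) (x N i) ≤ 2 → j ≠ k → 19 / 20 ≤ dist (x N j) (x N k)) ∧ ∀ j : Fin N, dist (x N j)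 (x N i) ≤ 1 → Nat.card {k : Fin N // k ≠ j ∧ l k = l j ∧ dist (x N j) (x N k) ≤ 1} = 6 ∧ Nat.card {k : Fin N // l k = l j + 1 ∧ dist (x N j) (x N k) ≤ 1} = 3 ∧ Nat.card {k : Fin N // l k = l j - 1 ∧ dist (x N j) (x N k) ≤ 1} = 3 ∧ ∀ k : Fin N, k ≠ j → dist (x N j) (x N k) ≤ 1 → (l k = l j → |dist (x N j) (x N k) - a| ≤ ε) ∧ (l k ≠ l j → |dist (x N j) (x N k) - b| ≤ ε))} : ℝ) / N) atTop (𝓝 0)) :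
    Summit.AtomisticToContinuum.Crystallization.Theses.LaminarSixThreeThree.StackingFaultSparsity :=
  OfLaminarBarlowWindows.StackingFaultSparsity_of_laminarBarlowWindows' (laminarBarlowWindows_of_goodFramesAE hG)

/-- **The crux (route `SquareWellLayerCake` copy) from a.e. GOOD`(2, 1, ε)` frames alone.** [folklore] -/
theorem stackingFaultSparsity_of_goodFramesAE'
    (hG : ∀ ε : ℝ, 0 < ε → ∀ x : (N : ℕ) → (Fin N → EuclideanSpace ℝ (Fin 3)),
      (∀ N, IsGroundState lennardJones (x N)) →
      Tendsto (fun N : ℕ => (Nat.card {i : Fin N // ¬ (∃ a b : ℝ, 19 / 20 ≤ a ∧ a ≤ 1 ∧ 19 / 20 ≤ b ∧ b ≤ 1 ∧ ∃ n : EuclideanSpace ℝ (Fin 3), ‖n‖ = 1 ∧ ∃ c : ℤ → ℝ, (∀ k : ℤ, c k + 19 / 25 ≤ c (k + 1)) ∧ ∃ l : Fin N → ℤ, (∀ j : Fin N, dist (x N j) (x N i) ≤ 2 → |inner ℝ (x N j - x N i) n - c (l j)| ≤ ε) ∧ (∀ j k : Fin N, dist (x N j) (x N i) ≤ 2 → dist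 (x N k) (x N i) ≤ 2 → j ≠ k → 19 / 20 ≤ dist (x N j) (x N k)) ∧ ∀ j : Fin N, dist (x N j) (x N i) ≤ 1 → Nat.card {k : Fin N // k ≠ j ∧ l k = l j ∧ dist (x N j) (x N k) ≤ 1} = 6 ∧ Nat.card {k : Fin N // l k = l j + 1 ∧ dist (x N j) (x N k) ≤ 1} = 3 ∧ Nat.card {k : Fin N // l k = l j - 1 ∧ dist (x N j) (x N k) ≤ 1} = 3 ∧ ∀ k : Fin N, k ≠ j → dist (x N j) (x N k) ≤ 1 → (l k = l j → |dist (x N j) (x N k) - a| ≤ ε) ∧ (l k ≠ l j → |dist (x N j) (x N k) - b| ≤ ε))} : ℝ) / N) atTop (𝓝 0)) :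
    Summit.AtomisticToContinuum.Crystallization.Theses.SquareWellLayerCake.StackingFaultSparsity :=
  OfLaminarBarlowWindows.StackingFaultSparsity_of_laminarBarlowWindows (laminarBarlowWindows_of_goodFramesAE hG)

end Summit.AtomisticToContinuum.Crystallization.Theorems.SquareWellLayerCake.StackingFaultSparsity.Bootstrap.Board

end
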